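/-
Copyright (c) 2026 the pub-hodgecm-mathlib formalisation cell (harness21).  Prover seat hodgecm-mathlib-F0P3-p02 (g26), 2026-09-03.  E1 row 41d R-d «THE FINITE SCHNEIDER–STUHLER
COMPLEX ON A STABLE SUBTREE», FILE II «ACTION + EQUIVARIANCE» (E1 keeper ∕ dealer F0P3a-p03 (g29) 01:39:03Z ∕ 01:44:40Z; census row 38 `CENSUS-SSK-via-resolution.v1` §3 (A6)).
-/
import Literature.NumberTheory.Automorphic.SchneiderStuhlerTreeComplexFinite   -- ★ 41d FILE I: `mem_zeroChains_iff`, `mem_oneChains_iff`, the `hD`∕`hE` letters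
import Literature.NumberTheory.Automorphic.SmoothFixedVectorGeneration       -- ★ row 23: `mem_fixedPoints_map_conj_iff`, `map_fixedPoints_eq_fixedPoints_map_conj` (transport `ρ(g) V^K = V^{gKg⁻¹}`)
import Mathlib.RepresentationTheory.Subrepresentation                          -- `Subrepresentation.toRepresentation`
import HarnessLib

/-!
# The finite Schneider–Stuhler complex of a subtree, II: the action of the stabiliser on `C₁(Σ), C₀(Σ), V|_Σ` and the equivariance of `∂` and `ε`

Topic `NumberTheory/Automorphic` (declarations in the `Representation` namespace, next to ★ FILE I `SchneiderStuhlerTreeComplexFinite`).  THEOREMS ONLY (no definition, no instance,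
no notation, no named fact, no `sorry`): the two representations on the big chain spaces are SUPPLIED BY EXISTENCE THEOREMS and then carried hypothesis-style through their
structural formula
  `hτ : ∀ g v, τ g v = Finsupp.mapRange (ρ g) (map_zero _) (Finsupp.equivMapDomain (a g).toEquiv v)`      (so `τ g v x = ρ g (v (a g⁻¹ x))`),
  `hτ₁ : ∀ g c, τ₁ g c = Finsupp.mapRange (ρ g) (map_zero _) (Finsupp.equivMapDomain (a g).mapEdgeSet c)`   (so `τ₁ g c e = ρ g (c ((a g⁻¹).mapEdgeSet e))`),
exactly as FILE I carries `D`, `E`.  Cell `pub/hodgecm-mathlib` (D-0151), crux H413 = `stmt-HodgeConjecture-24833`, lane `--supports`; E1 BRICK LEDGER row 41d = census row 38 §5 R-d,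
arrow (A6) («`(g·v)(x) = ρ g (v(g⁻¹x))`, `(g·c)(e) = ρ g (c(g⁻¹e))` (sign `+1`), compatible with `∂` and `ε`»).  HONEST LABEL: count-neutral generic base layer; E1 = PRINT until the
keeper's charter test; (R-SS) NOT chartered; HC_CM is proved only modulo the 2 remaining named inputs (hLiu418 = `stmt-HodgeConjecture-24832`, h413 = `stmt-HodgeConjecture-24833`)
until rung 0 closes.

THE MATHEMATICS ([SchneiderStuhler1997] II.3, III.4; [MeyerSolleveld2010] §4 Prop. 4.1; [Korman2004] §4).  `Γ` acts on the tree `G` through `a : Γ →* (G ≃g G)` (★ row 30b's letters);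
the vertex groups are TRANSPORTED, `U_{g·x} = g U_x g⁻¹` (`hUa`), and the orientation `σ` is INVARIANT, `head(g·e) = g·head(e)`, `tail(g·e) = g·tail(e)` (`hσa`; type-preserving
actions — ★ row 30b `exists_invariant_orientation_latticeGraph`).  Then `Γ` acts on `ι →₀ V` by `(g·v)(x) = ρ(g) v(g⁻¹x)` and on `G.edgeSet →₀ V` by `(g·c)(e) = ρ(g) c(g⁻¹e)`
(§1, as `Representation`s); an element `g` STABILISING the vertex set `Σ` (`hg : ∀ x, a g x ∈ Σ ↔ x ∈ Σ`) preserves `C₀(Σ)`, `C₁(Σ)` and `V|_Σ` (§2: `ρ(g) V^{U_x} = V^{U_{g·x}}`,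
★ row 23); the boundary and the augmentation are EQUIVARIANT, `∂(g·c) = g·∂c` (the incidence matrix is invariant: `D_{g·u, g·e} = D_{u,e}`), `ε(g·v) = ρ(g) ε(v)` (§3); and for the
stabiliser subgroup `P` of `Σ` the three modules are `Representation k P _` (restriction to an invariant submodule, Mathlib `Subrepresentation.toRepresentation`) on which the
restricted maps `i = ∂|`, `q = ε|` INTERTWINE (§4) — the letters of R-e «invariants of a compact group are exact» (`(i) (q) (hi hq : equivariant)`) and of R-f.

## References
* [SchneiderStuhler1997] P. Schneider, U. Stuhler, *Representation theory and sheaves on the Bruhat–Tits building*, Publ. Math. IHÉS 85 (1997): Ch. II §3 p. 123 (the `G`-equivariant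
  coefficient system and its oriented chain complex), Ch. III §4 (the action of a compact element on the complex of the fixed subcomplex).
* [MeyerSolleveld2010] R. Meyer, M. Solleveld, *Resolutions for representations of reductive p-adic groups via their buildings*, J. reine angew. Math. 647 (2010): §4 Prop. 4.1 («`C(Σ, Γ(V))`
  is a chain complex of `𝒢`-representations, so that `f` acts on it by chain maps»).
* [Korman2004] J. Korman, *A character formula for compact elements (the rank one case)*, arXiv:math/0409292: §4.
-/

set_option autoImplicit false

open scoped BigOperators Pointwise
open SimpleGraph Finset
open Literature.NumberTheory.Automorphic Literature.Combinatorics.SimpleGraph Literature.Combinatorics.SimpleGraph.OrientedIncidence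

namespace Representation

variable {k Γ V : Type*} [Field k] [CharZero k] [Group Γ] [TopologicalSpace Γ] [IsTopologicalGroup Γ]
  [AddCommGroup V] [Module k V] {ρ : Representation k Γ V}
variable {ι : Type*} [DecidableEq ι] {G : SimpleGraph ι} (a : Γ →* (G ≃g G))

/-! ## §1 The representations on the big chain spaces exist -/

omit [CharZero k] [TopologicalSpace Γ] [IsTopologicalGroup Γ] [DecidableEq ι] in
/-- **THE ACTION ON `0`-CHAINS EXISTS**: `Γ` acts on `ι →₀ V` by `(g·v)(x) = ρ(g) v(g⁻¹·x)`, i.e. `τ g = mapRange (ρ g) ∘ equivMapDomain (a g)` — a `Representation k Γ (ι →₀ V)`.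
[cite: SchneiderStuhler1997, Ch. II §3 p. 123] [cite: MeyerSolleveld2010, §4 Prop. 4.1] -/
theorem exists_rep_zeroChains (ρ : Representation k Γ V) :
    ∃ τ : Representation k Γ (ι →₀ V), ∀ (g : Γ) (v : ι →₀ V), τ g v = Finsupp.mapRange (ρ g) (map_zero _) (Finsupp.equivMapDomain (a g).toEquiv v) := by
  classical
  let L : Γ → ((ι →₀ V) →ₗ[k] (ι →₀ V)) := fun g =>
    (Finsupp.mapRange.linearMap (ρ g)) ∘ₗ (Finsupp.domLCongr (a g).toEquiv : (ι →₀ V) ≃ₗ[k] (ι →₀ V)).toLinearMap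
  have hL : ∀ g v x, L g v x = ρ g (v ((a g).symm x)) := fun g v x => rfl
  refine ⟨{ toFun := L, map_one' := ?_, map_mul' := fun g h => ?_ }, fun g v => rfl⟩
  · refine LinearMap.ext fun v => Finsupp.ext fun x => ?_
    rw [hL, map_one, map_one]
    rfl
  · refine LinearMap.ext fun v => Finsupp.ext fun x => ?_
    rw [Module.End.mul_apply, hL, hL, hL, map_mul, map_mul, Module.End.mul_apply]
    rfl

omit [CharZero k] [TopologicalSpace Γ] [IsTopologicalGroup Γ] [DecidableEq ι] in
/-- **THE ACTION ON `1`-CHAINS EXISTS**: `Γ` acts on `G.edgeSet →₀ V` by `(g·c)(e) = ρ(g) c(g⁻¹·e)`, i.e. `τ₁ g = mapRange (ρ g) ∘ equivMapDomain (a g).mapEdgeSet` (sign `+1`: no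
orientation character, the orientation being invariant). [cite: SchneiderStuhler1997, Ch. II §3 p. 123] [cite: MeyerSolleveld2010, §4 Prop. 4.1] -/
theorem exists_rep_oneChains (ρ : Representation k Γ V) :
    ∃ τ₁ : Representation k Γ (G.edgeSet →₀ V), ∀ (g : Γ) (c : G.edgeSet →₀ V), τ₁ g c = Finsupp.mapRange (ρ g) (map_zero _) (Finsupp.equivMapDomain (a g).mapEdgeSet c) := by
  classical
  let L : Γ → ((G.edgeSet →₀ V) →ₗ[k] (G.edgeSet →₀ V)) := fun g =>
    (Finsupp.mapRange.linearMap (ρ g)) ∘ₗ (Finsupp.domLCongr (a g).mapEdgeSet : (G.edgeSet →₀ V) ≃ₗ[k] (G.edgeSet →₀ V)).toLinearMap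
  have hL : ∀ g c e, L g c e = ρ g (c ((a g).mapEdgeSet.symm e)) := fun g c e => rfl
  -- the edge maps compose: `(g h)⁻¹·e = h⁻¹·(g⁻¹·e)` through `Sym2.map`
  have hsymm : ∀ (φ : G ≃g G) (e : G.edgeSet), ((φ.mapEdgeSet.symm e : G.edgeSet) : Sym2 ι) = Sym2.map φ.symm (e : Sym2 ι) := fun φ e => rfl
  have hid : ∀ z : Sym2 ι, Sym2.map (⇑((1 : G ≃g G).symm)) z = z := fun z => by
    induction z using Sym2.ind with
    | _ x y => rfl
  have hcomp : ∀ (φ ψ : G ≃g G) (z : Sym2 ι), Sym2.map (⇑(φ * ψ).symm) z = Sym2.map (⇑ψ.symm) (Sym2.map (⇑φ.symm) z) := fun φ ψ z => by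
    induction z using Sym2.ind with
    | _ x y => rfl
  refine ⟨{ toFun := L, map_one' := ?_, map_mul' := fun g h => ?_ }, fun g c => rfl⟩
  · refine LinearMap.ext fun c => Finsupp.ext fun e => ?_
    rw [hL, map_one]
    have he : (a 1).mapEdgeSet.symm e = e := by
      apply Subtype.ext
      rw [hsymm, map_one, hid]
    rw [he]; rfl
  · refine LinearMap.ext fun c => Finsupp.ext fun e => ?_
    rw [Module.End.mul_apply, hL, hL, hL, map_mul, map_mul, Module.End.mul_apply]
    have he : (a g * a h).mapEdgeSet.symm e = (a h).mapEdgeSet.symm ((a g).mapEdgeSet.symm e) := by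
      apply Subtype.ext
      rw [hsymm, hsymm, hsymm, hcomp]
    rw [he]

/-! ## §2 Pointwise formulas; the stabiliser of `Σ` preserves `C₀(Σ)`, `C₁(Σ)`, `V|_Σ` -/

section Pointwise

variable {a}
variable {τ : Representation k Γ (ι →₀ V)} (hτ : ∀ (g : Γ) (v : ι →₀ V), τ g v = Finsupp.mapRange (ρ g) (map_zero _) (Finsupp.equivMapDomain (a g).toEquiv v))
variable {τ₁ : Representation k Γ (G.edgeSet →₀ V)}
  (hτ₁ : ∀ (g : Γ) (c : G.edgeSet →₀ V), τ₁ g c = Finsupp.mapRange (ρ g) (map_zero _) (Finsupp.equivMapDomain (a g).mapEdgeSet c))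

omit [CharZero k] [TopologicalSpace Γ] [IsTopologicalGroup Γ] [DecidableEq ι] in
include hτ in
/-- `(g·v)(x) = ρ(g) v(g⁻¹·x)`. [cite: SchneiderStuhler1997, Ch. II §3 p. 123] -/
theorem rep_zeroChains_apply (g : Γ) (v : ι →₀ V) (x : ι) : τ g v x = ρ g (v (a g⁻¹ x)) := by
  rw [hτ, Finsupp.mapRange_apply, Finsupp.equivMapDomain_apply, map_inv]
  rfl

omit [CharZero k] [TopologicalSpace Γ] [IsTopologicalGroup Γ] [DecidableEq ι] in
include hτ₁ in
/-- `(g·c)(e) = ρ(g) c(g⁻¹·e)`. [cite: SchneiderStuhler1997, Ch. II §3 p. 123] -/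
theorem rep_oneChains_apply (g : Γ) (c : G.edgeSet →₀ V) (e : G.edgeSet) : τ₁ g c e = ρ g (c ((a g⁻¹).mapEdgeSet e)) := by
  rw [hτ₁, Finsupp.mapRange_apply, Finsupp.equivMapDomain_apply, map_inv]
  rfl

omit [CharZero k] [TopologicalSpace Γ] [IsTopologicalGroup Γ] [DecidableEq ι] in
/-- `g·(g⁻¹·x) = x` for the action on vertices. [cite: SchneiderStuhler1997, Ch. II §3 p. 123] -/
theorem act_act_inv (g : Γ) (x : ι) : a g (a g⁻¹ x) = x := by
  rw [map_inv]; exact RelIso.apply_inv_self _ _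

omit [CharZero k] [TopologicalSpace Γ] [IsTopologicalGroup Γ] [DecidableEq ι] in
/-- The ends of `g⁻¹·e` are `g⁻¹·head(e)`, `g⁻¹·tail(e)` for an invariant orientation. [cite: SchneiderStuhler1997, Ch. II §3 p. 123] -/
theorem head_tail_mapEdgeSet_inv (σ : Orientation G) (hσa : ∀ (g : Γ) (e : G.edgeSet), σ.head ((a g).mapEdgeSet e) = a g (σ.head e) ∧ σ.tail ((a g).mapEdgeSet e) = a g (σ.tail e))
    (g : Γ) (e : G.edgeSet) : σ.head ((a g⁻¹).mapEdgeSet e) = a g⁻¹ (σ.head e) ∧ σ.tail ((a g⁻¹).mapEdgeSet e) = a g⁻¹ (σ.tail e) :=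
  hσa g⁻¹ e

omit [CharZero k] [TopologicalSpace Γ] [IsTopologicalGroup Γ] [DecidableEq ι] in
include hτ in
/-- **THE STABILISER OF `Σ` PRESERVES `C₀(Σ)`**: if `g` stabilises `S` (`a g x ∈ S ↔ x ∈ S`) and the vertex groups are transported (`U_{g·x} = g U_x g⁻¹`), then `g·C₀(S) ⊆ C₀(S)`
(`ρ(g) V^{U_x} = V^{U_{g·x}}`, ★ row 23). [cite: SchneiderStuhler1997, Ch. II §3 p. 123] [cite: MeyerSolleveld2010, §4 Prop. 4.1] -/
theorem rep_zeroChains_mem_zeroChains (U : ι → Subgroup Γ) (S : Set ι) (hUa : ∀ (g : Γ) (x : ι), U (a g x) = (U x).map (MulAut.conj g).toMonoidHom)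
    {g : Γ} (hg : ∀ x, a g x ∈ S ↔ x ∈ S) {v : ι →₀ V} (hv : v ∈ ⨆ x ∈ S, (ρ.fixedPoints (U x)).map (Finsupp.lsingle x : V →ₗ[k] ι →₀ V)) :
    τ g v ∈ ⨆ x ∈ S, (ρ.fixedPoints (U x)).map (Finsupp.lsingle x : V →ₗ[k] ι →₀ V) := by
  rw [mem_zeroChains_iff] at hv ⊢
  obtain ⟨hvS, hvfix⟩ := hv
  refine ⟨fun x hx => ?_, fun x => ?_⟩
  · rw [Finsupp.mem_support_iff, rep_zeroChains_apply hτ] at hx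
    have hx' : v (a g⁻¹ x) ≠ 0 := fun h => hx (by rw [h, map_zero])
    have := hvS _ (Finsupp.mem_support_iff.2 hx')
    rwa [← hg, act_act_inv] at this
  · rw [rep_zeroChains_apply hτ]
    have h := (ρ.mem_fixedPoints_map_conj_iff (U (a g⁻¹ x)) g (v (a g⁻¹ x))).2 (hvfix _)
    rwa [← hUa, act_act_inv] at h

omit [CharZero k] [TopologicalSpace Γ] [IsTopologicalGroup Γ] [DecidableEq ι] in
include hτ₁ in
/-- **THE STABILISER OF `Σ` PRESERVES `C₁(Σ)`** (transported vertex groups, invariant orientation). [cite: SchneiderStuhler1997, Ch. II §3 p. 123] [cite: MeyerSolleveld2010, §4 Prop. 4.1] -/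
theorem rep_oneChains_mem_oneChains (σ : Orientation G) (U : ι → Subgroup Γ) (S : Set ι) (hUa : ∀ (g : Γ) (x : ι), U (a g x) = (U x).map (MulAut.conj g).toMonoidHom)
    (hσa : ∀ (g : Γ) (e : G.edgeSet), σ.head ((a g).mapEdgeSet e) = a g (σ.head e) ∧ σ.tail ((a g).mapEdgeSet e) = a g (σ.tail e))
    {g : Γ} (hg : ∀ x, a g x ∈ S ↔ x ∈ S) {c : G.edgeSet →₀ V}
    (hc : c ∈ ⨆ e ∈ {e : G.edgeSet | σ.head e ∈ S ∧ σ.tail e ∈ S}, (ρ.fixedPoints (U (σ.head e) ⊔ U (σ.tail e))).map (Finsupp.lsingle e : V →ₗ[k] G.edgeSet →₀ V)) :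
    τ₁ g c ∈ ⨆ e ∈ {e : G.edgeSet | σ.head e ∈ S ∧ σ.tail e ∈ S}, (ρ.fixedPoints (U (σ.head e) ⊔ U (σ.tail e))).map (Finsupp.lsingle e : V →ₗ[k] G.edgeSet →₀ V) := by
  rw [mem_oneChains_iff] at hc ⊢
  obtain ⟨hcS, hcfix⟩ := hc
  refine ⟨fun e he => ?_, fun e => ?_⟩
  · rw [Finsupp.mem_support_iff, rep_oneChains_apply hτ₁] at he
    have he' : c ((a g⁻¹).mapEdgeSet e) ≠ 0 := fun h => he (by rw [h, map_zero])
    obtain ⟨h1, h2⟩ := hcS _ (Finsupp.mem_support_iff.2 he')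
    rw [(head_tail_mapEdgeSet_inv σ hσa g e).1] at h1
    rw [(head_tail_mapEdgeSet_inv σ hσa g e).2] at h2
    rw [← hg, act_act_inv] at h1 h2
    exact ⟨h1, h2⟩
  · rw [rep_oneChains_apply hτ₁]
    have h := (ρ.mem_fixedPoints_map_conj_iff (U (σ.head ((a g⁻¹).mapEdgeSet e)) ⊔ U (σ.tail ((a g⁻¹).mapEdgeSet e))) g _).2 (hcfix ((a g⁻¹).mapEdgeSet e))
    rwa [Subgroup.map_sup, (head_tail_mapEdgeSet_inv σ hσa g e).1, (head_tail_mapEdgeSet_inv σ hσa g e).2, ← hUa, ← hUa, act_act_inv, act_act_inv] at h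

omit [CharZero k] [TopologicalSpace Γ] [IsTopologicalGroup Γ] [DecidableEq ι] in
/-- **THE STABILISER OF `Σ` PRESERVES `V|_Σ = ⨆_{x ∈ Σ} V^{U_x}`** (`ρ(g) V^{U_x} = V^{U_{g·x}}`, ★ row 23). [cite: SchneiderStuhler1997, Ch. II §3 p. 123] [cite: MeyerSolleveld2010, Thm. 2.4] -/
theorem rep_mem_restricted (U : ι → Subgroup Γ) (S : Set ι) (hUa : ∀ (g : Γ) (x : ι), U (a g x) = (U x).map (MulAut.conj g).toMonoidHom)
    {g : Γ} (hg : ∀ x, a g x ∈ S ↔ x ∈ S) {w : V} (hw : w ∈ ⨆ x ∈ S, ρ.fixedPoints (U x)) : ρ g w ∈ ⨆ x ∈ S, ρ.fixedPoints (U x) := by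
  have hle : (⨆ x ∈ S, ρ.fixedPoints (U x)).map (ρ g) ≤ ⨆ x ∈ S, ρ.fixedPoints (U x) := by
    rw [Submodule.map_iSup]
    refine iSup_le fun x => ?_
    rw [Submodule.map_iSup]
    refine iSup_le fun hx => ?_
    rw [ρ.map_fixedPoints_eq_fixedPoints_map_conj, ← hUa]
    exact le_biSup (fun y => ρ.fixedPoints (U y)) ((hg x).2 hx)
  exact hle ⟨w, hw, rfl⟩

/-! ## §3 Equivariance of the boundary and the augmentation -/

omit [CharZero k] [Group Γ] [TopologicalSpace Γ] [IsTopologicalGroup Γ] in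
/-- The incidence matrix is invariant under an orientation-preserving automorphism: `D_{φ u, φ e} = D_{u, e}` (cf. ★ row 30b `incMatrix_map_mapEdgeSet_of_head_mapEdgeSet_eq`).
[cite: GodsilRoyle2001, §8.3 (p. 167)] -/
theorem incMatrix_act (σ : Orientation G) (φ : G ≃g G) (hφ : ∀ e : G.edgeSet, σ.head (φ.mapEdgeSet e) = φ (σ.head e) ∧ σ.tail (φ.mapEdgeSet e) = φ (σ.tail e))
    (u : ι) (e : G.edgeSet) : σ.incMatrix k (φ u) (φ.mapEdgeSet e) = σ.incMatrix k u e := by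
  rw [Orientation.incMatrix_apply, Orientation.incMatrix_apply, (hφ e).1, (hφ e).2]
  have hinj : Function.Injective φ := φ.injective
  simp only [hinj.eq_iff]

omit [CharZero k] [TopologicalSpace Γ] [IsTopologicalGroup Γ] in
include hτ hτ₁ in
/-- **THE BOUNDARY IS EQUIVARIANT: `D(g·c) = g·(D c)`** for the actions of §1, an invariant orientation and `D` with ★ FILE I's `hD`. [cite: SchneiderStuhler1997, Ch. II §3 p. 123]
[cite: MeyerSolleveld2010, §4 Prop. 4.1] -/
theorem boundaryMap_rep (σ : Orientation G) (hσa : ∀ (g : Γ) (e : G.edgeSet), σ.head ((a g).mapEdgeSet e) = a g (σ.head e) ∧ σ.tail ((a g).mapEdgeSet e) = a g (σ.tail e))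
    {D : (G.edgeSet →₀ V) →ₗ[k] (ι →₀ V)} (hD : ∀ (c : G.edgeSet →₀ V) (u : ι), D c u = c.sum fun e m => σ.incMatrix k u e • m)
    (g : Γ) (c : G.edgeSet →₀ V) : D (τ₁ g c) = τ g (D c) := by
  classical
  refine Finsupp.ext fun u => ?_
  rw [hD, hτ₁, Finsupp.sum_mapRange_index (fun e => smul_zero _), Finsupp.sum_equivMapDomain, rep_zeroChains_apply hτ, hD, map_finsuppSum]
  refine Finset.sum_congr rfl fun e _ => ?_
  dsimp only
  rw [map_smul]
  congr 1
  -- `D_{u, g·e} = D_{g⁻¹u, e}`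
  have h := incMatrix_act (k := k) σ (a g) (hσa g) (a g⁻¹ u) e
  rw [act_act_inv] at h
  exact h

omit [CharZero k] [TopologicalSpace Γ] [IsTopologicalGroup Γ] [DecidableEq ι] in
include hτ in
/-- **THE AUGMENTATION IS EQUIVARIANT: `E(g·v) = ρ(g) E(v)`.** [cite: SchneiderStuhler1997, Ch. II §3 p. 123] [cite: MeyerSolleveld2010, §4 Prop. 4.1] -/
theorem augmentationMap_rep {E : (ι →₀ V) →ₗ[k] V} (hE : ∀ v : ι →₀ V, E v = v.sum fun _ m => m) (g : Γ) (v : ι →₀ V) : E (τ g v) = ρ g (E v) := by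
  classical
  rw [hE, hE, hτ, Finsupp.sum_mapRange_index (fun _ => rfl), Finsupp.sum_equivMapDomain, map_finsuppSum]

end Pointwise

/-! ## §4 The three modules as representations of the stabiliser subgroup; the restricted maps intertwine -/

omit [CharZero k] [TopologicalSpace Γ] [IsTopologicalGroup Γ] [DecidableEq ι] in
/-- **RESTRICTION TO AN INVARIANT SUBMODULE**: a representation `τ` of `Γ` on `M` and a submodule `W` stable under a subgroup `P` give a `Representation k P W` agreeing with `τ`
(Mathlib `Subrepresentation.toRepresentation` of `τ|_P`). [cite: MeyerSolleveld2010, §4 Prop. 4.1] -/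
theorem exists_rep_submodule {M : Type*} [AddCommGroup M] [Module k M] (τ : Representation k Γ M) (P : Subgroup Γ) (W : Submodule k M)
    (hW : ∀ g ∈ P, ∀ w ∈ W, τ g w ∈ W) : ∃ τW : Representation k P W, ∀ (g : P) (w : W), ((τW g w : W) : M) = τ (g : Γ) w := by
  let τP : Representation k P M := (τ : Γ →* (M →ₗ[k] M)).comp P.subtype
  let S : Subrepresentation τP := ⟨W, fun g w hw => hW g g.2 w hw⟩
  exact ⟨S.toRepresentation, fun g w => rfl⟩

omit [CharZero k] [TopologicalSpace Γ] [IsTopologicalGroup Γ] [DecidableEq ι] in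
/-- **INTERTWINING OF RESTRICTED MAPS**: if `f : M → N` intertwines `τ, τ′` and maps `W` into `W′`, then its restriction intertwines the restricted representations (whatever
representations on `W, W′` agree with `τ, τ′`). [cite: MeyerSolleveld2010, §4 Prop. 4.1] -/
theorem restrict_equivariant {M N : Type*} [AddCommGroup M] [Module k M] [AddCommGroup N] [Module k N] {τ : Representation k Γ M} {τ' : Representation k Γ N}
    {P : Subgroup Γ} {W : Submodule k M} {W' : Submodule k N} {τW : Representation k P W} {τW' : Representation k P W'}
    (hτW : ∀ (g : P) (w : W), ((τW g w : W) : M) = τ (g : Γ) w) (hτW' : ∀ (g : P) (w : W'), ((τW' g w : W') : N) = τ' (g : Γ) w)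
    (f : M →ₗ[k] N) (hf : ∀ w ∈ W, f w ∈ W') (hequi : ∀ (g : Γ) (m : M), f (τ g m) = τ' g (f m)) (g : P) (w : W) :
    f.restrict hf (τW g w) = τW' g (f.restrict hf w) := by
  apply Subtype.ext
  rw [LinearMap.coe_restrict_apply, hτW, hequi, hτW', LinearMap.coe_restrict_apply]

omit [CharZero k] [TopologicalSpace Γ] [IsTopologicalGroup Γ] in
/-- **THE FINITE COMPLEX IS A COMPLEX OF `P`-REPRESENTATIONS WITH INTERTWINING MAPS.**  For the stabiliser subgroup `P` of `Σ` (`hP`), transported vertex groups and an invariant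
orientation: there are representations of `P` on `C₁(Σ)`, `C₀(Σ)`, `V|_Σ` agreeing with `τ₁`, `τ`, `ρ`, and for ANY `D`, `E` with ★ FILE I's `hD`, `hE` mapping `C₁(Σ) → C₀(Σ) → V|_Σ`
(the user's `hDC`, `hEC`) the restricted maps `i = D|`, `q = E|` INTERTWINE them — the letters `(ρA ρM ρB) (i q) (hi hq)` of R-e `exact_fixedPoints_of_exact`.
[cite: MeyerSolleveld2010, §4 Prop. 4.1] [cite: SchneiderStuhler1997, Ch. III §4] [cite: Korman2004, §4] -/
theorem exists_reps_restrict_intertwining (σ : Orientation G) (U : ι → Subgroup Γ) (S : Set ι)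
    (hUa : ∀ (g : Γ) (x : ι), U (a g x) = (U x).map (MulAut.conj g).toMonoidHom)
    (hσa : ∀ (g : Γ) (e : G.edgeSet), σ.head ((a g).mapEdgeSet e) = a g (σ.head e) ∧ σ.tail ((a g).mapEdgeSet e) = a g (σ.tail e))
    {P : Subgroup Γ} (hP : ∀ g ∈ P, ∀ x, a g x ∈ S ↔ x ∈ S)
    {τ : Representation k Γ (ι →₀ V)} (hτ : ∀ (g : Γ) (v : ι →₀ V), τ g v = Finsupp.mapRange (ρ g) (map_zero _) (Finsupp.equivMapDomain (a g).toEquiv v))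
    {τ₁ : Representation k Γ (G.edgeSet →₀ V)} (hτ₁ : ∀ (g : Γ) (c : G.edgeSet →₀ V), τ₁ g c = Finsupp.mapRange (ρ g) (map_zero _) (Finsupp.equivMapDomain (a g).mapEdgeSet c))
    {D : (G.edgeSet →₀ V) →ₗ[k] (ι →₀ V)} (hD : ∀ (c : G.edgeSet →₀ V) (u : ι), D c u = c.sum fun e m => σ.incMatrix k u e • m)
    {E : (ι →₀ V) →ₗ[k] V} (hE : ∀ v : ι →₀ V, E v = v.sum fun _ m => m)
    (hDC : ∀ c ∈ ⨆ e ∈ {e : G.edgeSet | σ.head e ∈ S ∧ σ.tail e ∈ S}, (ρ.fixedPoints (U (σ.head e) ⊔ U (σ.tail e))).map (Finsupp.lsingle e : V →ₗ[k] G.edgeSet →₀ V),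
      D c ∈ ⨆ x ∈ S, (ρ.fixedPoints (U x)).map (Finsupp.lsingle x : V →ₗ[k] ι →₀ V))
    (hEC : ∀ v ∈ ⨆ x ∈ S, (ρ.fixedPoints (U x)).map (Finsupp.lsingle x : V →ₗ[k] ι →₀ V), E v ∈ ⨆ x ∈ S, ρ.fixedPoints (U x)) :
    ∃ (ρ₁ : Representation k P ↥(⨆ e ∈ {e : G.edgeSet | σ.head e ∈ S ∧ σ.tail e ∈ S}, (ρ.fixedPoints (U (σ.head e) ⊔ U (σ.tail e))).map (Finsupp.lsingle e : V →ₗ[k] G.edgeSet →₀ V)))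
      (ρ₀ : Representation k P ↥(⨆ x ∈ S, (ρ.fixedPoints (U x)).map (Finsupp.lsingle x : V →ₗ[k] ι →₀ V)))
      (ρV : Representation k P ↥(⨆ x ∈ S, ρ.fixedPoints (U x))),
      (∀ (g : P) c, ((ρ₁ g c : _) : G.edgeSet →₀ V) = τ₁ (g : Γ) c) ∧ (∀ (g : P) v, ((ρ₀ g v : _) : ι →₀ V) = τ (g : Γ) v) ∧
      (∀ (g : P) w, ((ρV g w : _) : V) = ρ (g : Γ) w) ∧
      (∀ (g : P) c, D.restrict hDC (ρ₁ g c) = ρ₀ g (D.restrict hDC c)) ∧ (∀ (g : P) v, E.restrict hEC (ρ₀ g v) = ρV g (E.restrict hEC v)) := by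
  obtain ⟨ρ₁, hρ₁⟩ := exists_rep_submodule τ₁ P _ fun g hg c hc => rep_oneChains_mem_oneChains hτ₁ σ U S hUa hσa (hP g hg) hc
  obtain ⟨ρ₀, hρ₀⟩ := exists_rep_submodule τ P _ fun g hg v hv => rep_zeroChains_mem_zeroChains hτ U S hUa (hP g hg) hv
  obtain ⟨ρV, hρV⟩ := exists_rep_submodule ρ P _ fun g hg w hw => rep_mem_restricted (a := a) U S hUa (hP g hg) hw
  exact ⟨ρ₁, ρ₀, ρV, hρ₁, hρ₀, hρV,
    fun g c => restrict_equivariant hρ₁ hρ₀ D hDC (fun g' c' => boundaryMap_rep hτ hτ₁ σ hσa hD g' c') g c,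
    fun g v => restrict_equivariant hρ₀ hρV E hEC (fun g' v' => augmentationMap_rep hτ hE g' v') g v⟩

end Representation
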